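import Literature.MathematicalPhysics.QuantumFieldTheory.Balaban1983to89.B8SectERemainderTraceFree
import HarnessLib

/-!
# `hP1room` PROGRAMME (LEAD-H «H = hSupU» BOARD v2 (S3), RULING L-10), (A-1) STAGE 3b FILE A: ★★ THE LOWER FAMILY ROWS (C) OF THE TOP STEP —
# (1.121), (1.125) and the reality covariance of N05's remainder `C′_j(u₁⁻¹, ·)` at the levels `j < k`, from Theorem 4's inductive datum AT `u₁`

Route `UnitScaleTilt`, crux K1 child «MinimiserStabilityRegPr» (stmt-QuantumFields-19200), registered stub `stub_halvingStep` (`BirthV10`), text `hP1room ⟸ hSupU`;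
the rows fed are block (C) `hC121lo`∕`hC125lo`∕`hCreallo` of ✓`P1FlatCoreTopStepTorus.hFP_kLevel_top_RD` (✓p636261), whose instantiation at the door's letters is STAGE 3b
(✓`HalvingP1FlatCoreSupplierDoor.hSup_of_contentRows`, ✓p643656, rows [R-e] `htop`, [R-f], and the inputs of ✓`HalvingP1FlatCoreSupplierLandau`).  Cell `ym3-torus` (HUMAN RULING
D-0037: YM₃ on T³ is ladder rung R3 — NOT d = 4, NOT a mass gap, NOT the Clay problem), width seat `ym-ust-20520-w3` gen 6.  `--supports stmt-QuantumFields-19200 --as helper`;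
THEOREMS ONLY (0 `def`, 0 `sorry`); count-neutral; nothing here claims `core′`, `hP1room`, `hSupU`, the stub, the crux or the gap.

WHAT.  In pub-ymgap N05's JOIN-C (✓`B8Prop5JoinSectE.exists_Dprime_map` ∕ ✓`B8Prop5JoinSectELocalRD.hFP_kLevel_of_sectE_local'_RD`) the Sect. E rows of [3]'s remainder
`Cnl L U₀ u₁⁻¹ j` are consumed INSIDE the contraction; the H-line's top step ✓p636261 (over ✓p632037 `hFP_kLevel_family_RD`) takes them as three DISPLAYED rows of an abstract family at
the levels `j < k`.  This file states those three rows ONCE, in ✓p636261's letters, from Theorem 4's inductive datum in the ORIGINAL pair's regime (everything AT `u₁`, nothing at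
`u₁⁻¹`): ★★ `lowerFamily_rows` — for `U₀` unitary, `1 ≤ d`, `2 ≤ L`, the tower structure `Λ`, the tower-local (1.33) `h33`, (1.69) `h69` (`U₁ = e^{B}` unitary-valued, `hBu`), the
full-field regularity `hP`, (1.34) `InAx` and (1.29) `Restr129` for `u₁`, and dag-n05-b's windows at `2α₄` (`α₃ = 40d·c`; `hsmall hc₃ hsc hα₃' hs₁ … hs₇ hprod8` — the JOIN's letters
VERBATIM): (1.121) `‖C′_j(u₁⁻¹, μ)(y)‖ ≤ C2p·(40dc + α₄)·α₄` on the (1.120)-set (sup `< α₄`, covariant gradient `< α₄L^{−j}` on the tower of `y`), (1.125)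
`‖C′_j(u₁⁻¹, μ₁)(y) − C′_j(u₁⁻¹, μ₂)(y)‖ ≤ (2·C2p·(40dc + 2α₄))·m` for a tower modulus `m` of `μ₁ − μ₂`, and `C′_j(u₁⁻¹, −μ⋆)(y) = −C′_j(u₁⁻¹, μ)(y)⋆` — at EVERY `(j ≤ k, y ∈ Λ_j)`
(the consumer restricts to `j < k`).  MECHANISM: ✓`B8SectEInLambdaWitness.witness_inv_of_axial` (the `Λ_j`-witness of `u₁⁻¹` on every tower) fed to
✓`norm_Cnl_le_tower_of_witness` (at `α₄`) and ✓`lipschitz_Cnl_tower_of_witness` (at `2α₄`, so that the (1.120)-set of size `α₄` is its half-size set), and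
✓`B8SectERemainderCovariance.Cnl_negStar_inv_of_axial` (windows at `4α₄` from those at `2α₄` + `hprod8`, ✓`hFP_kLevel_of_sectE_local'_RD`'s arithmetic).
HONEST SCOPE: by-name packaging of dag-n04-b∕n05-b's kernel theorems; no analysis; nothing of Prop. 5, Theorem 4, `core′` or the stub is proved here.

References: T. Bałaban, CMP **99** (1985) 75–102 [Balaban1985RegularSpaces] (Sect. E (1.112)–(1.125) pp.95–97, (1.68)–(1.69) p.88, (1.29) p.81, (1.19) p.79);
CMP **98** (1985) 17–51 [Balaban1985Averaging] ((106) p.33, (166)–(167) p.44, Prop. 10 (203)–(204), (213)–(214) p.50).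
-/

set_option autoImplicit false

noncomputable section

open NormedSpace

namespace Summit.QuantumFields.YangMills.Theorems.HalvingP1FlatCoreSupplierLowerFamily

open Literature.MathematicalPhysics.QuantumFieldTheory.Balaban1983to89
open B7Prop1Explicit B7Prop2Explicit B7Prop3Flat B7Prop1Local B7Eq167Flat B7Eq167General
open B7Eq170Flat (cj)
open B7Prop10General (C6 C4G)
open B7Prop10Flat (one_le_C5 C4'_nonneg C5'_nonneg)
open B7Prop9Flat (C5')
open B8Ineq130 (tlo thi)
open B7Eq92Concrete (mgauge)
open B8Eq119TwistedAxial (InAx Restr129)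
open B8Eq1123Concrete (Cnl)
open B8Ineq125Concrete (C2p C2p_nonneg)
open B8SectEInLambdaWitness (norm_Cnl_le_tower_of_witness lipschitz_Cnl_tower_of_witness witness_inv_of_axial)
open B8SectERemainderCovariance (Cnl_negStar_inv_of_axial)
open B8SectERemainderTraceFree (apply_Cnl_inv_of_axial)
open MatrixLog (mlog)

variable {d : ℕ} {𝔸 : Type*} [CStarAlgebra 𝔸] [Nontrivial 𝔸]

/-- ★★ **THE LOWER FAMILY ROWS (C) OF THE TOP STEP FROM THEOREM 4's INDUCTIVE DATUM** — (1.121), (1.125) and the reality covariance of `C′_j(u₁⁻¹, ·)` at every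
`(j ≤ k, y ∈ Λ_j)`, in the letters of ✓`P1FlatCoreTopStepTorus.hFP_kLevel_top_RD`'s `hC121lo`∕`hC125lo`∕`hCreallo` (there read at `U₀ := 1`, `j < k`), constants
`Cb := C2p·(40dc + α₄)·α₄`, `Cl := 2·C2p·(40dc + 2α₄)`.  Hypotheses = ✓`B8SectEInLambdaWitness.witness_inv_of_axial`'s (the original pair's regime) + the JOIN's windows at `2α₄`.
[cite: Balaban1985RegularSpaces, (1.112)-(1.125) pp.95-97, (1.68)-(1.69) p.88, (1.29) p.81; Balaban1985Averaging, (106) p.33, (213)-(214) p.50] -/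
theorem lowerFamily_rows (hd : 1 ≤ d) {L : ℕ} (hL : 2 ≤ L) {U₀ : Site d → Fin d → 𝔸ˣ} (hU₀ : ∀ x κ, U₀ x κ ∈ unitaryUnits 𝔸)
    {k : ℕ} (Λ : ℕ → Set (Site d)) {α₀ αP α₄ c : ℝ} {B : Site d → Fin d → 𝔸} {u₁ : Site d → 𝔸ˣ}
    (hα : 0 < α₀) (hα3 : C0 d * α₀ ≤ 1 / 3) (hα4 : 4 * α₀ ≤ c2' d L) (hc : 0 ≤ c) (hα₄ : 0 < α₄)
    (hαP : 0 < αP) (hαP3 : C0 d * αP ≤ 1 / 3) (hαP2 : 2 * αP ≤ c2' d L)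
    (hBu : ∀ (x : Site d) (κ : Fin d), expCfg B x κ ∈ unitaryUnits 𝔸)
    (h33 : ∀ j, j ≤ k → ∀ y ∈ Λ j, pdevOn (tlo L y j) (thi L y j) U₀ < α₀ * (((L : ℝ) ^ j)⁻¹) ^ 2)
    (h69 : ∀ j, j ≤ k → ∀ y ∈ Λ j, ∀ (x : Site d) (κ : Fin d), InBox (tlo L y j) (thi L y j) x →
      InBox (tlo L y j) (thi L y j) (x + e κ) → ‖B x κ‖ ≤ c * ((L : ℝ) ^ j)⁻¹)
    (hP : ∀ j, j ≤ k → ∀ y ∈ Λ j, pdevOn (tlo L y j) (thi L y j) (expCfg B * U₀) < αP * (((L : ℝ) ^ j)⁻¹) ^ 2)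
    (hAx : InAx L k Λ U₀ (mgauge U₀ u₁ (expCfg B) * U₀)) (h129 : Restr129 L k Λ U₀ u₁)
    (hsmall : Real.exp (4 * (800 * ((d : ℝ) + 1) ^ 2 * ((d : ℝ) + 4)) * α₀) * (1 + 8 * (131072 * ((d : ℝ) + 1) ^ 2) * c) ≤ 2)
    (hc₃ : 2 * c ≤ c3 d L) (hsc : 2048 * (d : ℝ) * c ≤ 1) (hα₃' : 40 * d * c ≤ 1 / 200)
    (hs₁ : 200 * C6 d * (2 * α₄) ≤ 1) (hs₂ : 12000 * ((d : ℝ) + 1) * L * (2 * α₄) ≤ 1)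
    (hs₃ : C4G d L * (α₀ + 40 * d * c + 4 * (2 * α₄)) ≤ 1)
    (hs₄ : 1024 * ((d : ℝ) + 1) * ((d : ℝ) + 4) * L ^ 2 * α₀ ≤ 1) (hs₅ : 32 * ((d : ℝ) + 1) ^ 2 * C6 d * L ^ 2 * α₀ ≤ 1)
    (hs₆ : 16 * d * C5' d * C6 d * (L : ℝ) ^ 2 * α₀ ≤ 1) (hs₇ : 8 * d * C6 d * L * α₀ ≤ 1)
    (hprod8 : 2 * C6 d * (40 * d * c + 4 * α₄) ≤ 1 / 8) :
    (∀ j, j ≤ k → ∀ y ∈ Λ j, ∀ μ : Site d → 𝔸,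
      (∀ x : Site d, InBox (tlo L y j) (thi L y j) x → ‖μ x‖ < α₄) →
      (∀ (x : Site d) (κ : Fin d), InBox (tlo L y j) (thi L y j) x → InBox (tlo L y j) (thi L y j) (x + e κ) →
        ‖cj (U₀ x κ) (μ (x + e κ)) - μ x‖ < α₄ * ((L : ℝ) ^ j)⁻¹) →
      ‖Cnl L U₀ u₁⁻¹ j μ y‖ ≤ C2p d * (40 * d * c + α₄) * α₄) ∧
    (∀ j, j ≤ k → ∀ y ∈ Λ j, ∀ (μ₁ μ₂ : Site d → 𝔸) (m : ℝ), 0 ≤ m →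
      (∀ x : Site d, InBox (tlo L y j) (thi L y j) x → ‖μ₁ x‖ < α₄) →
      (∀ (x : Site d) (κ : Fin d), InBox (tlo L y j) (thi L y j) x → InBox (tlo L y j) (thi L y j) (x + e κ) →
        ‖cj (U₀ x κ) (μ₁ (x + e κ)) - μ₁ x‖ < α₄ * ((L : ℝ) ^ j)⁻¹) →
      (∀ x : Site d, InBox (tlo L y j) (thi L y j) x → ‖μ₂ x‖ < α₄) →
      (∀ (x : Site d) (κ : Fin d), InBox (tlo L y j) (thi L y j) x → InBox (tlo L y j) (thi L y j) (x + e κ) →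
        ‖cj (U₀ x κ) (μ₂ (x + e κ)) - μ₂ x‖ < α₄ * ((L : ℝ) ^ j)⁻¹) →
      (∀ x : Site d, InBox (tlo L y j) (thi L y j) x → ‖(μ₁ - μ₂) x‖ ≤ m) →
      (∀ (x : Site d) (κ : Fin d), InBox (tlo L y j) (thi L y j) x → InBox (tlo L y j) (thi L y j) (x + e κ) →
        ‖cj (U₀ x κ) ((μ₁ - μ₂) (x + e κ)) - (μ₁ - μ₂) x‖ ≤ m * ((L : ℝ) ^ j)⁻¹) →
      ‖Cnl L U₀ u₁⁻¹ j μ₁ y - Cnl L U₀ u₁⁻¹ j μ₂ y‖ ≤ (2 * C2p d * (40 * d * c + 2 * α₄)) * m) ∧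
    (∀ j, j ≤ k → ∀ y ∈ Λ j, ∀ μ : Site d → 𝔸,
      (∀ x : Site d, InBox (tlo L y j) (thi L y j) x → ‖μ x‖ < α₄) →
      (∀ (x : Site d) (κ : Fin d), InBox (tlo L y j) (thi L y j) x → InBox (tlo L y j) (thi L y j) (x + e κ) →
        ‖cj (U₀ x κ) (μ (x + e κ)) - μ x‖ < α₄ * ((L : ℝ) ^ j)⁻¹) →
      Cnl L U₀ u₁⁻¹ j (fun x => -star (μ x)) y = -star (Cnl L U₀ u₁⁻¹ j μ y)) := by
  have hL1 : 1 ≤ L := le_trans (by norm_num) hL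
  have hC6 : (0 : ℝ) ≤ C6 d := by
    have : (2 : ℝ) ≤ C6 d := by unfold C6; linarith only [one_le_C5 (d := d)]
    linarith only [this]
  have hα₃ : (0 : ℝ) ≤ 40 * d * c := by positivity
  have hC4G : 0 ≤ C4G d L := by
    have h7 : (0 : ℝ) ≤ B7Prop10General.C7 d := by
      unfold B7Prop10General.C7 C6; linarith only [one_le_C5 (d := d), C5'_nonneg (d := d)]
    have h4' := C4'_nonneg (d := d)
    unfold C4G; positivity
  -- the windows at `α₄` and at `4α₄` from those at `2α₄` and `hprod8`
  have hs₁' : 200 * C6 d * α₄ ≤ 1 := by nlinarith only [hs₁, hC6, hα₄.le]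
  have hs₂' : 12000 * ((d : ℝ) + 1) * L * α₄ ≤ 1 := by
    nlinarith only [hs₂, hα₄.le, show (0 : ℝ) ≤ 12000 * ((d : ℝ) + 1) * L by positivity]
  have hs₃' : C4G d L * (α₀ + 40 * d * c + 4 * α₄) ≤ 1 :=
    (mul_le_mul_of_nonneg_left (by linarith only [hα₄]) hC4G).trans hs₃
  have h204w : C6 d * (4 * α₄) ≤ 1 / 8 := by nlinarith only [hprod8, hC6, hα₃, hα₄.le]
  have hd₁ : 10 * C6 d * (4 * α₄) ≤ 1 := by nlinarith only [hs₁, hC6, hα₄.le]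
  have hd₂ : 3000 * ((d : ℝ) + 1) * L * (4 * α₄) ≤ 1 := by
    have e1 : 3000 * ((d : ℝ) + 1) * L * (4 * α₄) = 12000 * ((d : ℝ) + 1) * L * (2 * α₄) / 2 := by ring
    rw [e1]; linarith only [hs₂, show (0 : ℝ) ≤ 12000 * ((d : ℝ) + 1) * L * (2 * α₄) by positivity]
  -- the `Λ_j`-witness of `u₁⁻¹` on every tower
  have hwit := witness_inv_of_axial hd hL hU₀ Λ hα hα3 hα4 hc hsmall hc₃ hsc hαP hαP3 hαP2 hL1 hBu h33 h69 hP hAx h129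
  refine ⟨?_, ?_, ?_⟩
  · -- (1.121)
    intro j hj y hy μ hμb hμa
    obtain ⟨ut, hW, hag⟩ := hwit j hj y hy
    exact norm_Cnl_le_tower_of_witness hL (avgClosed_unitaryUnits d L) hU₀ hα hα3 hα4 (h33 j hj y hy) hL1 hW hag hα₄ hμb hμa hα₃
      (by linarith only [hα₃']) hs₁' hs₂' hs₃' hs₄ hs₅ hs₆ hs₇
  · -- (1.125), at `2α₄` so that the (1.120)-set is the half-size set
    intro j hj y hy μ₁ μ₂ m hm h1b h1a h2b h2a hmb hma
    obtain ⟨ut, hW, hag⟩ := hwit j hj y hy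
    have h2α₄ : 0 < 2 * α₄ := by positivity
    have e : 2 * α₄ / 2 = α₄ := by ring
    have h := lipschitz_Cnl_tower_of_witness hL (avgClosed_unitaryUnits d L) hU₀ hα hα3 hα4 (h33 j hj y hy) hL1 hW hag h2α₄ hm
      (μ₁ := μ₁) (μ₂ := μ₂) (fun x hx => by rw [e]; exact h1b x hx) (fun x κ hx hxe => by rw [e]; exact h1a x κ hx hxe)
      (fun x hx => by rw [e]; exact h2b x hx) (fun x κ hx hxe => by rw [e]; exact h2a x κ hx hxe) hmb hma hα₃ (by linarith only [hα₃'])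
      hs₁ hs₂ hs₃ hs₄ hs₅ hs₆ hs₇
    refine h.trans_eq ?_
    ring
  · -- reality covariance
    exact Cnl_negStar_inv_of_axial Λ hd hL hL1 hU₀ hα hα3 hα4 hc hα₄ hαP hαP3 hαP2 hBu h33 h69 hP hAx h129 hsmall hc₃ hsc (by linarith only [hα₃'])
      hd₁ hd₂ hs₃' hs₄ hs₅ hs₆ hprod8 h204w


/-! ## §2 (v1.1) The τ-row of the lower family (joint J-SU; the `hCτlo` binder of the top step's τ-twin) -/

section Trace

variable {G H : Subgroup 𝔸ˣ} (τ : 𝔸 →L[ℂ] ℂ)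

/-- ★★ **THE LOWER FAMILY's τ-ROW FROM THEOREM 4's INDUCTIVE DATUM** (joint J-SU): for a tracial `τ`, groups `G ≤ H ≤ 𝔸ˣ` with (H2) `τ(log h) = 0` near `1` and (H3)
`e^{S} ∈ H` for `τ`-free `S`, `G` averaging-closed and unitary, the background `G`-valued and `u₁` `H`-valued: `τ(C′_j(u₁⁻¹, μ)(y)) = 0` for `τ`-free `μ` on the (1.120)-set
of every tower `(j ≤ k, y ∈ Λ_j)` — ✓`B8SectERemainderTraceFree.apply_Cnl_inv_of_axial` with the JOIN's windows at `2α₄` (the arithmetic of `lowerFamily_rows`); = the `hCτlo`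
binder of `P1FlatCoreTopStepTorus.hFP_kLevel_top_RD_traceFree` (there at `U₀ := 1`, `j < k`). [cite: Balaban1985RegularSpaces, p.76, (1.112)-(1.125) pp.95-97; Balaban1985Averaging, p.20, (78)-(80) p.30, (211)-(213) p.50] -/
theorem lowerFamily_traceRow (hτ : ∀ x y : 𝔸, τ (x * y) = τ (y * x))
    (hH2 : ∀ g ∈ H, ‖(g : 𝔸) - 1‖ ≤ 1 / 8 → τ (mlog (g : 𝔸)) = 0) (hH3 : ∀ S : 𝔸, τ S = 0 → expUnit S ∈ H)
    (hd : 1 ≤ d) {L : ℕ} (hL : 2 ≤ L) (hGA : AvgClosed d L G) (hGH : G ≤ H) (hGu : G ≤ unitaryUnits 𝔸)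
    {U₀ : Site d → Fin d → 𝔸ˣ} (hU₀G : ∀ x κ, U₀ x κ ∈ G)
    {k : ℕ} (Λ : ℕ → Set (Site d)) {α₀ αP α₄ c : ℝ} {B : Site d → Fin d → 𝔸} {u₁ : Site d → 𝔸ˣ} (hu₁H : ∀ x, u₁ x ∈ H)
    (hα : 0 < α₀) (hα3 : C0 d * α₀ ≤ 1 / 3) (hα4 : 4 * α₀ ≤ c2' d L) (hc : 0 ≤ c) (hα₄ : 0 < α₄)
    (hαP : 0 < αP) (hαP3 : C0 d * αP ≤ 1 / 3) (hαP2 : 2 * αP ≤ c2' d L)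
    (hBu : ∀ (x : Site d) (κ : Fin d), expCfg B x κ ∈ unitaryUnits 𝔸)
    (h33 : ∀ j, j ≤ k → ∀ y ∈ Λ j, pdevOn (tlo L y j) (thi L y j) U₀ < α₀ * (((L : ℝ) ^ j)⁻¹) ^ 2)
    (h69 : ∀ j, j ≤ k → ∀ y ∈ Λ j, ∀ (x : Site d) (κ : Fin d), InBox (tlo L y j) (thi L y j) x →
      InBox (tlo L y j) (thi L y j) (x + e κ) → ‖B x κ‖ ≤ c * ((L : ℝ) ^ j)⁻¹)
    (hP : ∀ j, j ≤ k → ∀ y ∈ Λ j, pdevOn (tlo L y j) (thi L y j) (expCfg B * U₀) < αP * (((L : ℝ) ^ j)⁻¹) ^ 2)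
    (hAx : InAx L k Λ U₀ (mgauge U₀ u₁ (expCfg B) * U₀)) (h129 : Restr129 L k Λ U₀ u₁)
    (hsmall : Real.exp (4 * (800 * ((d : ℝ) + 1) ^ 2 * ((d : ℝ) + 4)) * α₀) * (1 + 8 * (131072 * ((d : ℝ) + 1) ^ 2) * c) ≤ 2)
    (hc₃ : 2 * c ≤ c3 d L) (hsc : 2048 * (d : ℝ) * c ≤ 1) (hα₃' : 40 * d * c ≤ 1 / 200)
    (hs₁ : 200 * C6 d * (2 * α₄) ≤ 1) (hs₂ : 12000 * ((d : ℝ) + 1) * L * (2 * α₄) ≤ 1)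
    (hs₃ : C4G d L * (α₀ + 40 * d * c + 4 * (2 * α₄)) ≤ 1)
    (hs₄ : 1024 * ((d : ℝ) + 1) * ((d : ℝ) + 4) * L ^ 2 * α₀ ≤ 1) (hs₅ : 32 * ((d : ℝ) + 1) ^ 2 * C6 d * L ^ 2 * α₀ ≤ 1)
    (hs₆ : 16 * d * C5' d * C6 d * (L : ℝ) ^ 2 * α₀ ≤ 1)
    (hprod8 : 2 * C6 d * (40 * d * c + 4 * α₄) ≤ 1 / 8) :
    ∀ j, j ≤ k → ∀ y ∈ Λ j, ∀ μ : Site d → 𝔸, (∀ x, τ (μ x) = 0) →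
      (∀ x : Site d, InBox (tlo L y j) (thi L y j) x → ‖μ x‖ < α₄) →
      (∀ (x : Site d) (κ : Fin d), InBox (tlo L y j) (thi L y j) x → InBox (tlo L y j) (thi L y j) (x + e κ) →
        ‖cj (U₀ x κ) (μ (x + e κ)) - μ x‖ < α₄ * ((L : ℝ) ^ j)⁻¹) →
      τ (Cnl L U₀ u₁⁻¹ j μ y) = 0 := by
  have hL1 : 1 ≤ L := le_trans (by norm_num) hL
  have hC6 : (0 : ℝ) ≤ C6 d := by
    have : (2 : ℝ) ≤ C6 d := by unfold C6; linarith only [one_le_C5 (d := d)]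
    linarith only [this]
  have hα₃ : (0 : ℝ) ≤ 40 * d * c := by positivity
  have hC4G : 0 ≤ C4G d L := by
    have h7 : (0 : ℝ) ≤ B7Prop10General.C7 d := by
      unfold B7Prop10General.C7 C6; linarith only [one_le_C5 (d := d), C5'_nonneg (d := d)]
    have h4' := C4'_nonneg (d := d)
    unfold C4G; positivity
  have hs₃' : C4G d L * (α₀ + 40 * d * c + 4 * α₄) ≤ 1 :=
    (mul_le_mul_of_nonneg_left (by linarith only [hα₄]) hC4G).trans hs₃
  have h204w : C6 d * (4 * α₄) ≤ 1 / 8 := by nlinarith only [hprod8, hC6, hα₃, hα₄.le]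
  have hd₁ : 10 * C6 d * (4 * α₄) ≤ 1 := by nlinarith only [hs₁, hC6, hα₄.le]
  have hd₂ : 3000 * ((d : ℝ) + 1) * L * (4 * α₄) ≤ 1 := by
    have e1 : 3000 * ((d : ℝ) + 1) * L * (4 * α₄) = 12000 * ((d : ℝ) + 1) * L * (2 * α₄) / 2 := by ring
    rw [e1]; linarith only [hs₂, show (0 : ℝ) ≤ 12000 * ((d : ℝ) + 1) * L * (2 * α₄) by positivity]
  exact apply_Cnl_inv_of_axial τ hτ hH2 hH3 hGA hGH hGu Λ hd hL hL1 hU₀G hu₁H hα hα3 hα4 hc hα₄ hαP hαP3 hαP2 hBu h33 h69 hP hAx h129 hsmall hc₃ hsc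
    (by linarith only [hα₃']) hd₁ hd₂ hs₃' hs₄ hs₅ hs₆ hprod8 h204w

end Trace

end Summit.QuantumFields.YangMills.Theorems.HalvingP1FlatCoreSupplierLowerFamily

end
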